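import Literature.Combinatorics.StablePolynomials.RealStabilityPreserversNecessity
import Literature.Combinatorics.StablePolynomials.UnivariateStabilityPreservers
import Mathlib.Algebra.Polynomial.Basis
import Mathlib.RingTheory.Polynomial.Basic
import HarnessLib

/-!
# Real stability preservers on real polynomials of bounded degree in one variable
# (Borcea–Brändén I, Theorem 1.2, case `n = 1`)

J. Borcea, P. Brändén, *The Lee–Yang and Pólya–Schur programs. I. Linear operators preserving stability*,
Invent. Math. 177 (2009) 541–569 (arXiv:0809.0401), §1.1:

> **Theorem 1.2.** Let `κ ∈ ℕⁿ` and `T : ℝ_κ[z_1,…,z_n] → ℝ[z_1,…,z_n]` be a linear operator. Then `T`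
> preserves real stability if and only if either
> (a) `T` has range of dimension no greater than two and is of the form `T(f) = α(f)P + β(f)Q`, where
> `α, β : ℝ_κ[z_1,…,z_n] → ℝ` are linear functionals and `P, Q` are real stable polynomials such that
> `P ≪ Q`, or
> (b) `G_T(z,w) ∈ 𝓗_{2n}(ℝ)`, or
> (c) `G_T(z,-w) ∈ 𝓗_{2n}(ℝ)`.

This file proves the theorem for **`n = 1` and every degree `κ ≥ 1`** (`boundedDegree_realStabilityPreserver_iff`):
`ℝ_κ[t]` is the space of real polynomials of degree `≤ κ`, a real polynomial `p` is real stable when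
`p(t) ≠ 0` for `Im t > 0` (for real `p` of one variable: `p ≠ 0` with only real zeros), `P ≪ Q` (proper
position, §1.2) means `Q + iP` is stable, and `G_T(z,w) = T[(z+w)^κ] = Σ_k binom(κ,k) T(z^k)(z) w^{κ-k}`.
"Preserves real stability" is read, as in the paper, as `T(𝓗(ℝ) ∩ ℝ_κ[t]) ⊆ 𝓗(ℝ) ∪ {0}`.

## Proof (the reduction of §2.2 to the multi-affine case, as for Theorem 1.1)

With `σ` finite, `|σ| = κ`, `i₀ ∈ σ`, let `T̃ = ι ∘ T ∘ Π↓ : ℝ[z_σ] → ℝ[z_σ]` (`liftOpReal`; `ι(p) = p(z_{i₀})`,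
`Π↓` the diagonal projection). By `Π↓Π↑ = id` (with the real polarization `realPolarization`, whose
complexification is the tree's `polarization`) and Prop. 2.4 (Grace–Walsh–Szegő), `T` preserves real stability
on `ℝ_κ[t]` iff `T̃` preserves real stability on multi-affine polynomials (`liftOpReal_preserves`,
`preserves_of_liftOpReal`). The multi-affine Theorem 1.2 (tree: `multiAffine_realStabilityPreserver_iff`,
`forall_apply_or_symbol`, `RealStabilityPreservers(Necessity).lean`) applied to `T̃` gives three cases:
* all `T̃(h)` real stable or zero: then all `T(p)`, `p ∈ ℝ_κ[t]`, are real stable or zero and Lemma 3.2 (i)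
  with Theorem 1.9 (tree `not_linearIndependent_of_forall_mem`, `isProperPosition_or_of_forall_mem`, applied
  in `ℝ[z_σ] ⊇ ι(T(ℝ_κ[t]))`) give (a) (`exists_rankTwo_of_forall_apply_poly`);
* `G_{T̃}(z,w) ∈ 𝓗_{2κ}(ℝ)`: since `(T̃)_ℂ = ι ∘ T_ℂ ∘ Π↓` (`complexify_liftOpReal`) and `G_{(T̃)_ℂ} = G_{T̃}`, the
  comparison `G_{ι∘S∘Π↓} ∈ 𝓗_{2κ} ⇔ G_S ∈ 𝓗_2` of `UnivariateStabilityPreservers.lean` (Prop. 2.4 in `w`)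
  shows this is (b) (`isRealStable_realMultiAffineSymbol_liftOpReal_iff`);
* `G_{T̃}(z,-w) ∈ 𝓗_{2κ}(ℝ)`: `G_{T̃}(z,-w) = G_{T̃'}(z,w)` with `T̃' = (-1)^κ T̃(f(-z))` (tree
  `realMultiAffineSymbol_negTwist`), and `T̃' = (T')~` for `T'(p) = (-1)^κ T(p(-t))` (`negTwist_liftOpReal`),
  whose symbol is `G_{T'}(z,w) = G_T(z,-w)` (`univariateRealSymbol_flipTwist`); so this is (c).
The converse directions are Theorem 1.9 (Hermite–Kakeya–Obreschkoff, tree `IsProperPosition.pencil`) for (a)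
and the sufficiency half of the multi-affine theorem (tree `realStabilityPreserver_of_symbol(_neg)`) for (b), (c).

## Contents

* §1 `liftOpReal`, `map_diagonal`, `map_toMvPolynomial`, `isRealStable_toMvPolynomial_iff`, `realPolarization`
  (+ `map_realPolarization`, `diagonal_realPolarization`, `isRealStable_realPolarization`), `liftOpReal_preserves`,
  `preserves_of_liftOpReal`.
* §2 `complexifyPoly` (`T_ℂ`), `complexify_liftOpReal`, `univariateRealSymbol` (`G_T(z,w)`),
  `univariateRealSymbolNeg` (`G_T(z,-w)`), `isRealStable_realMultiAffineSymbol_liftOpReal_iff`, `flipTwist`,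
  `negTwist_liftOpReal`, `univariateRealSymbol_flipTwist`, `isRealStable_negInr_realMultiAffineSymbol_liftOpReal_iff`.
* §3 `isProperPosition_toMvPolynomial_iff`, `exists_rankTwo_of_forall_apply_poly`.
* §4 **`boundedDegree_realStabilityPreserver_iff_card`**, **`boundedDegree_realStabilityPreserver_iff`**.

## References

* [BorceaBranden2009] J. Borcea, P. Brändén, Invent. Math. 177 (2009) 541–569, §1.1 Thm. 1.2, §1.2 (`≪`,
  Thm. 1.6 Hermite–Biehler, Thm. 1.9, Cor. 1.10), §2.2 (Π↑, Π↓, Prop. 2.4), §3 Lemma 3.2, §4.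
-/

noncomputable section

open MvPolynomial Finset

namespace Literature.Combinatorics.StablePolynomials

variable {σ : Type*}

/-! ## §1 The real lift `T̃ = ι ∘ T ∘ Π↓` and the transfer of the preserver property -/

section RealLift

/-- **The real multi-affine lift `T̃ = ι ∘ T ∘ Π↓_κ`** of a linear operator `T` on `ℝ[t]` to `ℝ[z_σ]`:
`T̃(f) = T(Π↓ f)(z_{i₀})`. [cite: BorceaBranden2009, §2.2 ("questions about linear transformations … reduce
to questions about linear transformations on multi-affine polynomials")] -/
def liftOpReal (i₀ : σ) (T : Polynomial ℝ →ₗ[ℝ] Polynomial ℝ) : MvPolynomial σ ℝ →ₗ[ℝ] MvPolynomial σ ℝ :=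
  (Polynomial.toMvPolynomial i₀ : Polynomial ℝ →ₐ[ℝ] MvPolynomial σ ℝ).toLinearMap ∘ₗ T ∘ₗ
    (diagonal : MvPolynomial σ ℝ →ₐ[ℝ] Polynomial ℝ).toLinearMap

/-- `T̃(f) = ι(T(Π↓ f))`. [cite: BorceaBranden2009, §2.2 (Π↓_κ)] -/
theorem liftOpReal_apply (i₀ : σ) (T : Polynomial ℝ →ₗ[ℝ] Polynomial ℝ) (f : MvPolynomial σ ℝ) :
    liftOpReal i₀ T f = (T (diagonal f)).toMvPolynomial i₀ :=
  rfl

/-- `Π↓` commutes with complexification. [cite: BorceaBranden2009, §2.2 (Π↓_κ)] -/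
theorem map_diagonal (f : MvPolynomial σ ℝ) :
    (diagonal f).map (algebraMap ℝ ℂ) = diagonal (map (algebraMap ℝ ℂ) f) := by
  induction f using MvPolynomial.induction_on with
  | C a => rw [diagonal_C, Polynomial.map_C, map_C, diagonal_C]
  | add p q hp hq => rw [map_add, Polynomial.map_add, hp, hq, map_add, map_add]
  | mul_X p i hp => rw [map_mul, Polynomial.map_mul, hp, diagonal_X, Polynomial.map_X, map_mul, map_X, map_mul,
      diagonal_X]

/-- `ι` commutes with complexification. [cite: BorceaBranden2009, §4 proof of Thm. 1.2 (complexification)] -/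
theorem map_toMvPolynomial (i₀ : σ) (p : Polynomial ℝ) :
    map (algebraMap ℝ ℂ) (p.toMvPolynomial i₀) = (p.map (algebraMap ℝ ℂ)).toMvPolynomial i₀ := by
  induction p using Polynomial.induction_on' with
  | add p q hp hq => rw [map_add, map_add, hp, hq, Polynomial.map_add, map_add]
  | monomial n a =>
    rw [← Polynomial.C_mul_X_pow_eq_monomial]
    simp only [Polynomial.map_mul, Polynomial.map_C, Polynomial.map_pow, Polynomial.map_X, map_mul, map_pow,
      Polynomial.toMvPolynomial_C, Polynomial.toMvPolynomial_X, map_C, map_X]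

/-- **`ι(p)` is real stable iff `p` is**: `p(z_{i₀}) ∈ 𝓗_σ(ℝ)` iff `p(t) ≠ 0` for `Im t > 0`.
[cite: BorceaBranden2009, §1 (real stable = real coefficients and stable)] -/
theorem isRealStable_toMvPolynomial_iff (i₀ : σ) (p : Polynomial ℝ) :
    IsRealStable (p.toMvPolynomial i₀) ↔ ∀ t : ℂ, 0 < t.im → (p.map (algebraMap ℝ ℂ)).eval t ≠ 0 := by
  rw [IsRealStable, map_toMvPolynomial, isUpperHalfPlaneStable_toMvPolynomial_iff]

variable [Fintype σ]

variable (σ) in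
/-- **The real polarization `Π↑_κ`** of a real polynomial of degree `≤ κ = |σ|`:
`Π↑(p) = Σ_k a_k binom(κ,k)⁻¹ e_k(z)` — real coefficients, complexifying to the tree's `polarization`.
[cite: BorceaBranden2009, §2.2 (definition of Π↑_κ, "`Π↑_κ(z^α) = binom(κ,α)⁻¹ E_α`")] -/
def realPolarization (p : Polynomial ℝ) : MvPolynomial σ ℝ :=
  ∑ k ∈ range (Fintype.card σ + 1), (p.coeff k / (((Fintype.card σ).choose k : ℕ) : ℝ)) • esymm σ ℝ k

/-- `Π↑` commutes with complexification. [cite: BorceaBranden2009, §2.2 (Π↑_κ)] -/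
theorem map_realPolarization (p : Polynomial ℝ) :
    map (algebraMap ℝ ℂ) (realPolarization σ p) = polarization σ (p.map (algebraMap ℝ ℂ)) := by
  rw [realPolarization, polarization, map_sum]
  refine sum_congr rfl fun k _ => ?_
  rw [smul_eq_C_mul, smul_eq_C_mul, map_mul, map_C, map_esymm, Polynomial.coeff_map, map_div₀, map_natCast]

/-- `Π↑ p` is multi-affine. [cite: BorceaBranden2009, §2.2 ("`Π↑_κ(f)` … multi-affine")] -/
theorem isMultiAffine_realPolarization (p : Polynomial ℝ) : IsMultiAffine (realPolarization σ p) :=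
  isMultiAffine_map_algebraMap_iff.1 (by rw [map_realPolarization]; exact isMultiAffine_polarization _)

variable [DecidableEq σ]

omit [DecidableEq σ] in
/-- **`Π↓(Π↑ p) = p`** for real `p` of degree `≤ κ`. [cite: BorceaBranden2009, §2.2 ("(b) `Π↓_κ ∘ Π↑_κ = id`")] -/
theorem diagonal_realPolarization {p : Polynomial ℝ} (hp : p.natDegree ≤ Fintype.card σ) :
    diagonal (realPolarization σ p) = p := by
  apply Polynomial.map_injective (algebraMap ℝ ℂ) (algebraMap ℝ ℂ).injective
  rw [map_diagonal, map_realPolarization, diagonal_polarization]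
  rwa [Polynomial.natDegree_map_eq_of_injective (algebraMap ℝ ℂ).injective]

/-- **`Π↑` preserves real stability** (Prop. 2.4): for real `p` of degree `≤ κ` with `p(t) ≠ 0` on `Im t > 0`,
`Π↑ p` is real stable. [cite: BorceaBranden2009, §2.2 Prop. 2.4] -/
theorem isRealStable_realPolarization {p : Polynomial ℝ} (hp : p.natDegree ≤ Fintype.card σ)
    (hs : ∀ t : ℂ, 0 < t.im → (p.map (algebraMap ℝ ℂ)).eval t ≠ 0) : IsRealStable (realPolarization σ p) := by
  rw [IsRealStable, map_realPolarization]
  refine isUpperHalfPlaneStable_polarization ?_ hs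
  rwa [Polynomial.natDegree_map_eq_of_injective (algebraMap ℝ ℂ).injective]

omit [DecidableEq σ] in
/-- `Π↓ f` has degree `≤ κ` for real multi-affine `f`. [cite: BorceaBranden2009, §2.2 (Π↓_κ maps `ℝ_{(1,…,1)}`
to `ℝ_κ[t]`)] -/
theorem natDegree_diagonal_le_real {f : MvPolynomial σ ℝ} (hf : IsMultiAffine f) :
    (diagonal f).natDegree ≤ Fintype.card σ := by
  rw [eq_multiAffine_of_isMultiAffine_real hf]
  exact natDegree_diagonal_multiAffine_le _

omit [DecidableEq σ] in
/-- **`T` preserves real stability on `ℝ_κ[t]` ⇒ `T̃` preserves real stability on multi-affine polynomials.**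
[cite: BorceaBranden2009, §2.2 ("(a) The linear operators `Π↑_κ` and `Π↓_κ` preserve stability")] -/
theorem liftOpReal_preserves (i₀ : σ) (T : Polynomial ℝ →ₗ[ℝ] Polynomial ℝ)
    (hT : ∀ p : Polynomial ℝ, p.natDegree ≤ Fintype.card σ →
      (∀ t : ℂ, 0 < t.im → (p.map (algebraMap ℝ ℂ)).eval t ≠ 0) →
        (∀ t : ℂ, 0 < t.im → ((T p).map (algebraMap ℝ ℂ)).eval t ≠ 0) ∨ T p = 0)
    {f : MvPolynomial σ ℝ} (hf : IsMultiAffine f) (hs : IsRealStable f) :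
    IsRealStable (liftOpReal i₀ T f) ∨ liftOpReal i₀ T f = 0 := by
  have hds : ∀ t : ℂ, 0 < t.im → ((diagonal f).map (algebraMap ℝ ℂ)).eval t ≠ 0 := fun t ht => by
    rw [map_diagonal, eval_diagonal]
    exact hs _ fun _ => ht
  rw [liftOpReal_apply]
  rcases hT _ (natDegree_diagonal_le_real hf) hds with h | h
  · exact Or.inl ((isRealStable_toMvPolynomial_iff i₀ _).2 h)
  · exact Or.inr (by rw [h, map_zero])

/-- **`T̃` preserves real stability on multi-affine polynomials ⇒ `T` preserves real stability on `ℝ_κ[t]`**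
(through `ι(T p) = T̃(Π↑ p)`). [cite: BorceaBranden2009, §2.2 Prop. 2.4 and "(b) `Π↓_κ ∘ Π↑_κ = id`"] -/
theorem preserves_of_liftOpReal (i₀ : σ) (T : Polynomial ℝ →ₗ[ℝ] Polynomial ℝ)
    (hT : ∀ f : MvPolynomial σ ℝ, IsMultiAffine f → IsRealStable f →
      IsRealStable (liftOpReal i₀ T f) ∨ liftOpReal i₀ T f = 0)
    {p : Polynomial ℝ} (hp : p.natDegree ≤ Fintype.card σ)
    (hs : ∀ t : ℂ, 0 < t.im → (p.map (algebraMap ℝ ℂ)).eval t ≠ 0) :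
    (∀ t : ℂ, 0 < t.im → ((T p).map (algebraMap ℝ ℂ)).eval t ≠ 0) ∨ T p = 0 := by
  have h := hT (realPolarization σ p) (isMultiAffine_realPolarization p) (isRealStable_realPolarization hp hs)
  rw [liftOpReal_apply, diagonal_realPolarization hp] at h
  rcases h with h | h
  · exact Or.inl ((isRealStable_toMvPolynomial_iff i₀ _).1 h)
  · exact Or.inr (Polynomial.toMvPolynomial_injective i₀ (by rw [h, map_zero]))

end RealLift

/-! ## §2 Complexification and the two symbols `G_T(z,±w)` -/

section Symbols

/-- **The complexification `T_ℂ`** of an `ℝ`-linear operator on `ℝ[t]`: the `ℂ`-linear operator on `ℂ[t]` with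
`T_ℂ(t^k) = T(t^k)`. [cite: BorceaBranden2009, §4 proof of Thm. 1.2 ("the desired conclusion simply follows
from the complex case")] -/
def complexifyPoly (T : Polynomial ℝ →ₗ[ℝ] Polynomial ℝ) : Polynomial ℂ →ₗ[ℂ] Polynomial ℂ :=
  (Polynomial.basisMonomials ℂ).constr ℂ fun k => (T (Polynomial.monomial k 1)).map (algebraMap ℝ ℂ)

/-- `T_ℂ` on monomials. [cite: BorceaBranden2009, §4 proof of Thm. 1.2] -/
theorem complexifyPoly_monomial (T : Polynomial ℝ →ₗ[ℝ] Polynomial ℝ) (k : ℕ) (c : ℂ) :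
    complexifyPoly T (Polynomial.monomial k c) = c • (T (Polynomial.monomial k 1)).map (algebraMap ℝ ℂ) := by
  have h : (Polynomial.monomial k c : Polynomial ℂ) = c • Polynomial.basisMonomials ℂ k := by
    rw [Polynomial.coe_basisMonomials, Polynomial.smul_monomial, smul_eq_mul, mul_one]
  rw [h, map_smul, complexifyPoly, Module.Basis.constr_basis]

/-- **`T_ℂ` extends `T`.** [cite: BorceaBranden2009, §4 proof of Thm. 1.2] -/
theorem complexifyPoly_map (T : Polynomial ℝ →ₗ[ℝ] Polynomial ℝ) (p : Polynomial ℝ) :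
    complexifyPoly T (p.map (algebraMap ℝ ℂ)) = (T p).map (algebraMap ℝ ℂ) := by
  induction p using Polynomial.induction_on' with
  | add p q hp hq => rw [Polynomial.map_add, map_add, hp, hq, map_add, Polynomial.map_add]
  | monomial k a =>
    rw [Polynomial.map_monomial, complexifyPoly_monomial,
      show (Polynomial.monomial k a : Polynomial ℝ) = a • Polynomial.monomial k 1 by
        rw [Polynomial.smul_monomial, smul_eq_mul, mul_one],
      LinearMap.map_smul, Polynomial.map_smul]

variable [Fintype σ] [DecidableEq σ]

omit [Fintype σ] [DecidableEq σ] in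
/-- `ι ∘ T_ℂ ∘ Π↓` agrees with the complexification of `T̃` on complexified real polynomials.
[cite: BorceaBranden2009, §4 proof of Thm. 1.2 (complex case applied to a real operator)] -/
theorem liftOp_complexifyPoly_map (i₀ : σ) (T : Polynomial ℝ →ₗ[ℝ] Polynomial ℝ) (f : MvPolynomial σ ℝ) :
    liftOp i₀ (complexifyPoly T) (map (algebraMap ℝ ℂ) f) = map (algebraMap ℝ ℂ) (liftOpReal i₀ T f) := by
  rw [liftOp_apply, liftOpReal_apply, ← map_diagonal, complexifyPoly_map, map_toMvPolynomial]

omit [Fintype σ] [DecidableEq σ] in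
/-- **`(T̃)_ℂ = ι ∘ T_ℂ ∘ Π↓`.** [cite: BorceaBranden2009, §4 proof of Thm. 1.2] -/
theorem complexify_liftOpReal (i₀ : σ) (T : Polynomial ℝ →ₗ[ℝ] Polynomial ℝ) :
    complexify (liftOpReal i₀ T) = liftOp i₀ (complexifyPoly T) := by
  refine (basisMonomials σ ℂ).ext fun m => ?_
  have hm : (basisMonomials σ ℂ m : MvPolynomial σ ℂ) = map (algebraMap ℝ ℂ) (monomial m 1) := by
    rw [coe_basisMonomials, map_monomial, map_one]
  rw [hm, complexify_map, liftOp_complexifyPoly_map]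

/-- **The symbol `G_T(z,w) = T[(z+w)^κ] = Σ_k binom(κ,k) T(z^k)(z) w^{κ-k} ∈ ℝ[z,w]`** of a real operator on
`ℝ_κ[t]` (variables `z = X 0`, `w = X 1`). [cite: BorceaBranden2009, §1.1 (definition of G_T), Thm. 1.2 (b)] -/
def univariateRealSymbol (κ : ℕ) (T : Polynomial ℝ →ₗ[ℝ] Polynomial ℝ) : MvPolynomial (Fin 2) ℝ :=
  ∑ k ∈ range (κ + 1), ((κ.choose k : ℕ) : ℝ) • ((T (Polynomial.X ^ k)).toMvPolynomial 0 * X 1 ^ (κ - k))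

/-- **The symbol `G_T(z,-w) = Σ_k binom(κ,k) T(z^k)(z) (-w)^{κ-k} ∈ ℝ[z,w]`.**
[cite: BorceaBranden2009, §1.1 Thm. 1.2 (c)] -/
def univariateRealSymbolNeg (κ : ℕ) (T : Polynomial ℝ →ₗ[ℝ] Polynomial ℝ) : MvPolynomial (Fin 2) ℝ :=
  ∑ k ∈ range (κ + 1), ((κ.choose k : ℕ) : ℝ) • ((T (Polynomial.X ^ k)).toMvPolynomial 0 * (-X 1) ^ (κ - k))

/-- `G_T` complexifies to `G_{T_ℂ}`. [cite: BorceaBranden2009, §1.1 (G_T) and §4 proof of Thm. 1.2] -/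
theorem map_univariateRealSymbol (κ : ℕ) (T : Polynomial ℝ →ₗ[ℝ] Polynomial ℝ) :
    map (algebraMap ℝ ℂ) (univariateRealSymbol κ T) = univariateSymbol κ (complexifyPoly T) := by
  rw [univariateRealSymbol, univariateSymbol, map_sum]
  refine sum_congr rfl fun k _ => ?_
  rw [smul_eq_C_mul, smul_eq_C_mul, map_mul, map_mul, map_C, map_natCast,
    _root_.map_pow (MvPolynomial.map (algebraMap ℝ ℂ)), map_X, map_toMvPolynomial,
    show (Polynomial.X ^ k : Polynomial ℂ) = (Polynomial.X ^ k : Polynomial ℝ).map (algebraMap ℝ ℂ) by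
      rw [Polynomial.map_pow, Polynomial.map_X],
    complexifyPoly_map]

omit [DecidableEq σ] in
/-- `|σ| = κ` copies of `t + w` multiply to `(t+w)^κ`; here: the real symbol of `T̃` is real stable iff
`G_T ∈ 𝓗_2(ℝ)` — **(b) for `T̃` is (b) for `T`**, through `(T̃)_ℂ = ι ∘ T_ℂ ∘ Π↓`, `G_{(T̃)_ℂ} = G_{T̃}` and the
`w`-polarization comparison (Prop. 2.4). [cite: BorceaBranden2009, §2.2 Prop. 2.4 and §4 proof of Thm. 1.2
("we may therefore assume that `G_T(z,w)` is real stable. But then the desired conclusion simply follows from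
the complex case")] -/
theorem isRealStable_realMultiAffineSymbol_liftOpReal_iff [DecidableEq σ] (i₀ : σ)
    (T : Polynomial ℝ →ₗ[ℝ] Polynomial ℝ) :
    IsRealStable (realMultiAffineSymbol (liftOpReal i₀ T)) ↔
      IsRealStable (univariateRealSymbol (Fintype.card σ) T) := by
  rw [IsRealStable, IsRealStable, ← multiAffineSymbol_complexify, complexify_liftOpReal,
    isUpperHalfPlaneStable_multiAffineSymbol_liftOp_iff, map_univariateRealSymbol,
    isUpperHalfPlaneStable_univariateSymbol_iff]

/-- **The flipped operator `T'(p) = (-1)^κ T(p(-t))`**, whose symbol is `G_{T'}(z,w) = G_T(z,-w)`.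
[cite: BorceaBranden2009, §4 proof of Thm. 1.2 ("`T'(f)(z) = (-1)^κ T(f(-z))`")] -/
def flipTwist (κ : ℕ) (T : Polynomial ℝ →ₗ[ℝ] Polynomial ℝ) : Polynomial ℝ →ₗ[ℝ] Polynomial ℝ :=
  ((-1 : ℝ) ^ κ) • (T ∘ₗ (Polynomial.aeval (-Polynomial.X : Polynomial ℝ)).toLinearMap)

/-- `T'(p) = (-1)^κ T(p(-t))`. [cite: BorceaBranden2009, §4 proof of Thm. 1.2] -/
theorem flipTwist_apply (κ : ℕ) (T : Polynomial ℝ →ₗ[ℝ] Polynomial ℝ) (p : Polynomial ℝ) :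
    flipTwist κ T p = ((-1 : ℝ) ^ κ) • T (p.comp (-Polynomial.X)) :=
  rfl

omit [Fintype σ] [DecidableEq σ] in
/-- `Π↓(f(-z)) = (Π↓ f)(-t)`. [cite: BorceaBranden2009, §4 (𝓗_n^- and `f(-z)`)] -/
theorem diagonal_negVars (f : MvPolynomial σ ℝ) : diagonal (negVars f) = (diagonal f).comp (-Polynomial.X) := by
  have h : (diagonal : MvPolynomial σ ℝ →ₐ[ℝ] Polynomial ℝ).comp negVars =
      (Polynomial.aeval (-Polynomial.X : Polynomial ℝ)).comp diagonal := by
    refine MvPolynomial.algHom_ext fun i => ?_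
    rw [AlgHom.comp_apply, AlgHom.comp_apply, negVars, bind₁_X_right, map_neg, diagonal_X,
      ← Polynomial.comp_eq_aeval, Polynomial.X_comp]
  have h' := congrArg (fun φ => φ f) h
  simpa [Polynomial.comp_eq_aeval] using h'

omit [DecidableEq σ] in
/-- **`(T̃)' = (T')~`**: the twist `f ↦ (-1)^κ T̃(f(-z))` of the lift is the lift of `T'(p) = (-1)^κ T(p(-t))`.
[cite: BorceaBranden2009, §4 proof of Thm. 1.2 ("these operators are related by `T'(f)(z) = (-1)^κ T(f(-z))`")] -/
theorem negTwist_liftOpReal (i₀ : σ) (T : Polynomial ℝ →ₗ[ℝ] Polynomial ℝ) :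
    negTwist (liftOpReal i₀ T) = liftOpReal i₀ (flipTwist (Fintype.card σ) T) := by
  refine LinearMap.ext fun f => ?_
  rw [negTwist_apply, liftOpReal_apply, liftOpReal_apply, flipTwist_apply, diagonal_negVars, map_smul]

omit [Fintype σ] [DecidableEq σ] in
/-- `(-1)^κ (-1)^k = (-1)^{κ-k}` for `k ≤ κ`. [folklore] -/
private theorem neg_one_pow_mul_neg_one_pow {R : Type*} [CommRing R] {κ k : ℕ} (hk : k ≤ κ) :
    ((-1 : R) ^ κ) * (-1) ^ k = (-1) ^ (κ - k) := by
  conv_lhs => rw [← Nat.sub_add_cancel hk, pow_add]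
  rw [mul_assoc, ← pow_add, ← two_mul, pow_mul, neg_one_sq, one_pow, mul_one]

omit [Fintype σ] [DecidableEq σ] in
/-- **`G_{T'}(z,w) = G_T(z,-w)`.** [cite: BorceaBranden2009, §4 proof of Thm. 1.2 ("linear operators whose symbols
satisfy `G_{T'}(z,w) = G_T(z,-w)`")] -/
theorem univariateRealSymbol_flipTwist (κ : ℕ) (T : Polynomial ℝ →ₗ[ℝ] Polynomial ℝ) :
    univariateRealSymbol κ (flipTwist κ T) = univariateRealSymbolNeg κ T := by
  rw [univariateRealSymbol, univariateRealSymbolNeg]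
  refine sum_congr rfl fun k hk => ?_
  have hk' : k ≤ κ := Nat.lt_succ_iff.1 (mem_range.1 hk)
  have hflip : flipTwist κ T (Polynomial.X ^ k) = ((-1 : ℝ) ^ (κ - k)) • T (Polynomial.X ^ k) := by
    rw [flipTwist_apply, Polynomial.X_pow_comp, neg_pow (Polynomial.X : Polynomial ℝ), ← Polynomial.C_1,
      ← Polynomial.C_neg, ← Polynomial.C_pow, ← Polynomial.smul_eq_C_mul, map_smul T, smul_smul,
      neg_one_pow_mul_neg_one_pow hk']
  have hX : ((-X 1) ^ (κ - k) : MvPolynomial (Fin 2) ℝ) = ((-1 : ℝ) ^ (κ - k)) • X 1 ^ (κ - k) := by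
    rw [neg_pow (X 1 : MvPolynomial (Fin 2) ℝ), smul_eq_C_mul, map_pow, map_neg, map_one]
  rw [hflip, hX, map_smul, smul_mul_assoc, mul_smul_comm]

/-- **(c) for `T̃` is (c) for `T`**: `G_{T̃}(z,-w) ∈ 𝓗_{2κ}(ℝ)` iff `G_T(z,-w) ∈ 𝓗_2(ℝ)` — through
`G_{T̃}(z,-w) = G_{T̃'}(z,w)`, `T̃' = (T')~` and (b) for `T'`. [cite: BorceaBranden2009, §4 proof of Thm. 1.2
("hence they preserve real stability simultaneously")] -/
theorem isRealStable_negInr_realMultiAffineSymbol_liftOpReal_iff (i₀ : σ) (T : Polynomial ℝ →ₗ[ℝ] Polynomial ℝ) :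
    IsRealStable (negInr (realMultiAffineSymbol (liftOpReal i₀ T))) ↔
      IsRealStable (univariateRealSymbolNeg (Fintype.card σ) T) := by
  rw [← realMultiAffineSymbol_negTwist, negTwist_liftOpReal, isRealStable_realMultiAffineSymbol_liftOpReal_iff,
    univariateRealSymbol_flipTwist]

end Symbols

/-! ## §3 Proper position through `ι`, and the rank-two alternative -/

section RankTwo

/-- **`ι(P) ≪ ι(Q)` iff `P ≪ Q`**, the latter in the univariate form "`Q + iP` has no zeros in `Im t > 0`".
[cite: BorceaBranden2009, §1.2 (definition of proper position `≪`: `g + if ∈ 𝓗(ℂ)`)] -/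
theorem isProperPosition_toMvPolynomial_iff (i₀ : σ) (P Q : Polynomial ℝ) :
    IsProperPosition (P.toMvPolynomial i₀) (Q.toMvPolynomial i₀) ↔
      ∀ t : ℂ, 0 < t.im →
        (Q.map (algebraMap ℝ ℂ) + Polynomial.C Complex.I * P.map (algebraMap ℝ ℂ)).eval t ≠ 0 := by
  rw [IsProperPosition, map_toMvPolynomial, map_toMvPolynomial, ← isUpperHalfPlaneStable_toMvPolynomial_iff i₀,
    map_add, map_mul, Polynomial.toMvPolynomial_C]

/-- Coordinates along one nonzero vector. [folklore] -/
private theorem exists_coord_singleton {M : Type*} [AddCommGroup M] [Module ℝ M] {P : M} (hP : P ≠ 0) :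
    ∃ α : M →ₗ[ℝ] ℝ, ∀ a : ℝ, α (a • P) = a := by
  obtain ⟨L, hL⟩ := LinearMap.exists_leftInverse_of_injective
    (LinearMap.toSpanSingleton ℝ M P) (LinearMap.ker_toSpanSingleton ℝ hP)
  exact ⟨L, fun a => by simpa using LinearMap.congr_fun hL a⟩

/-- Coordinates along two independent vectors. [folklore] -/
private theorem exists_coord_pair {M : Type*} [AddCommGroup M] [Module ℝ M] {P Q : M}
    (hPQ : ∀ s t : ℝ, s • P + t • Q = 0 → s = 0 ∧ t = 0) :
    ∃ α β : M →ₗ[ℝ] ℝ, ∀ a b : ℝ, α (a • P + b • Q) = a ∧ β (a • P + b • Q) = b := by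
  set ψ : ℝ × ℝ →ₗ[ℝ] M := (LinearMap.toSpanSingleton ℝ M P).coprod (LinearMap.toSpanSingleton ℝ M Q)
    with hψ_def
  have hψ : ∀ ab : ℝ × ℝ, ψ ab = ab.1 • P + ab.2 • Q := fun ab => by
    simp [hψ_def]
  have hker : LinearMap.ker ψ = ⊥ := LinearMap.ker_eq_bot'.2 fun ab hab => by
    rw [hψ] at hab
    obtain ⟨h1, h2⟩ := hPQ _ _ hab
    exact Prod.ext h1 h2
  obtain ⟨L, hL⟩ := LinearMap.exists_leftInverse_of_injective ψ hker
  refine ⟨(LinearMap.fst ℝ ℝ ℝ).comp L, (LinearMap.snd ℝ ℝ ℝ).comp L, fun a b => ?_⟩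
  have hab := LinearMap.congr_fun hL (a, b)
  rw [LinearMap.comp_apply, hψ, LinearMap.id_apply] at hab
  simp [hab]

omit σ in
/-- `1 ≪ 1`-type facts: `(1 + i)·c ≠ 0` form — `Q + iP` at `P = Q`: `(1+i)P`. [folklore] -/
private theorem one_add_I_ne_zero : (1 : ℂ) + Complex.I ≠ 0 := fun h => by
  simpa using congrArg Complex.re h

variable [Fintype σ]

/-- **All `T(p)`, `p ∈ ℝ_κ[t]`, real stable or zero ⇒ (a)**: the image has dimension at most two (Lemma 3.2 (i),
applied to `ι(T(ℝ_κ[t])) ⊆ ℝ[z_σ]`), any two of its elements are comparable for `≪` (Thm. 1.9), and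
`T(p) = α(p)P + β(p)Q` with `P ≪ Q` real stable. [cite: BorceaBranden2009, §4 proof of Thm. 1.2 ("all nonzero
polynomials in the image of `T` are real stable and by Lemma 3.2 … the image of `T` is of dimension at most
two") and §3 Lemma 3.2 (i)] -/
theorem exists_rankTwo_of_forall_apply_poly (i₀ : σ) {κ : ℕ} (T : Polynomial ℝ →ₗ[ℝ] Polynomial ℝ)
    (himg : ∀ p : Polynomial ℝ, p.natDegree ≤ κ →
      T p = 0 ∨ ∀ t : ℂ, 0 < t.im → ((T p).map (algebraMap ℝ ℂ)).eval t ≠ 0) :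
    ∃ (α β : Polynomial ℝ →ₗ[ℝ] ℝ) (P Q : Polynomial ℝ),
      (∀ t : ℂ, 0 < t.im → (P.map (algebraMap ℝ ℂ)).eval t ≠ 0) ∧
      (∀ t : ℂ, 0 < t.im → (Q.map (algebraMap ℝ ℂ)).eval t ≠ 0) ∧
      (∀ t : ℂ, 0 < t.im →
        (Q.map (algebraMap ℝ ℂ) + Polynomial.C Complex.I * P.map (algebraMap ℝ ℂ)).eval t ≠ 0) ∧
      ∀ p : Polynomial ℝ, p.natDegree ≤ κ → T p = α p • P + β p • Q := by
  classical
  -- the space `V = ι(T(ℝ_κ[t])) ⊆ ℝ[z_σ]` of real-stable-or-zero polynomials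
  set ι : Polynomial ℝ →ₗ[ℝ] MvPolynomial σ ℝ :=
    (Polynomial.toMvPolynomial i₀ : Polynomial ℝ →ₐ[ℝ] MvPolynomial σ ℝ).toLinearMap with hι_def
  have hι : ∀ p : Polynomial ℝ, ι p = p.toMvPolynomial i₀ := fun p => rfl
  have hιinj : Function.Injective ι := fun p q h => Polynomial.toMvPolynomial_injective i₀ (by
    rwa [hι, hι] at h)
  set V : Submodule ℝ (MvPolynomial σ ℝ) := (Polynomial.degreeLE ℝ κ).map (ι ∘ₗ T) with hV_def
  have hdeg : ∀ p : Polynomial ℝ, p.natDegree ≤ κ → p ∈ Polynomial.degreeLE ℝ κ := fun p hp =>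
    Polynomial.mem_degreeLE.2 (Polynomial.natDegree_le_iff_degree_le.1 hp)
  have hmemV : ∀ p : Polynomial ℝ, p.natDegree ≤ κ → (T p).toMvPolynomial i₀ ∈ V := fun p hp =>
    Submodule.mem_map_of_mem (f := ι ∘ₗ T) (hdeg p hp)
  have hV : ∀ q ∈ V, q = 0 ∨ IsRealStable q := by
    intro q hq
    obtain ⟨p, hp, rfl⟩ := Submodule.mem_map.1 hq
    have hp' : p.natDegree ≤ κ :=
      Polynomial.natDegree_le_iff_degree_le.2 (Polynomial.mem_degreeLE.1 hp)
    rcases himg p hp' with h | h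
    · exact Or.inl (by rw [LinearMap.comp_apply, h, map_zero])
    · exact Or.inr ((isRealStable_toMvPolynomial_iff i₀ _).2 h)
  have hone_st : ∀ t : ℂ, 0 < t.im → ((1 : Polynomial ℝ).map (algebraMap ℝ ℂ)).eval t ≠ 0 := fun t _ => by
    rw [Polynomial.map_one, Polynomial.eval_one]
    exact one_ne_zero
  -- `P ≪ P` for univariate real stable `P`: `P + iP = (1+i)P`
  have hself : ∀ P : Polynomial ℝ, (∀ t : ℂ, 0 < t.im → (P.map (algebraMap ℝ ℂ)).eval t ≠ 0) →
      ∀ t : ℂ, 0 < t.im →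
        (P.map (algebraMap ℝ ℂ) + Polynomial.C Complex.I * P.map (algebraMap ℝ ℂ)).eval t ≠ 0 := by
    intro P hP t ht
    rw [← one_add_mul, Polynomial.eval_mul, Polynomial.eval_add, Polynomial.eval_one, Polynomial.eval_C]
    exact mul_ne_zero one_add_I_ne_zero (hP t ht)
  by_cases hzero : ∀ p : Polynomial ℝ, p.natDegree ≤ κ → T p = 0
  · refine ⟨0, 0, 1, 1, hone_st, hone_st, hself 1 hone_st, fun p hp => ?_⟩
    rw [hzero p hp, LinearMap.zero_apply, zero_smul, add_zero]
  push Not at hzero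
  obtain ⟨p₀, hp₀, hP0⟩ := hzero
  set P := T p₀ with hP_def
  have hPs : ∀ t : ℂ, 0 < t.im → (P.map (algebraMap ℝ ℂ)).eval t ≠ 0 := (himg p₀ hp₀).resolve_left hP0
  by_cases hline : ∀ p : Polynomial ℝ, p.natDegree ≤ κ → ∃ a : ℝ, T p = a • P
  · obtain ⟨α, hα⟩ := exists_coord_singleton hP0
    refine ⟨α.comp T, 0, P, P, hPs, hPs, hself P hPs, fun p hp => ?_⟩
    obtain ⟨a, ha⟩ := hline p hp
    rw [LinearMap.comp_apply, ha, hα, LinearMap.zero_apply, zero_smul, add_zero]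
  push Not at hline
  obtain ⟨p₁, hp₁, hQ⟩ := hline
  set Q := T p₁ with hQ_def
  have hQ0 : Q ≠ 0 := fun h => hQ 0 (by rw [h, zero_smul])
  have hQs : ∀ t : ℂ, 0 < t.im → (Q.map (algebraMap ℝ ℂ)).eval t ≠ 0 := (himg p₁ hp₁).resolve_left hQ0
  -- `P, Q` are linearly independent
  have hind : ∀ s t : ℝ, s • P + t • Q = 0 → s = 0 ∧ t = 0 := by
    intro s t hst
    by_cases ht : t = 0
    · rw [ht, zero_smul, add_zero] at hst
      exact ⟨(smul_eq_zero.1 hst).resolve_right hP0, ht⟩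
    · exfalso
      refine hQ (-(t⁻¹ * s)) ?_
      have hQ' : Q = t⁻¹ • (t • Q) := by rw [smul_smul, inv_mul_cancel₀ ht, one_smul]
      rw [hQ', eq_neg_of_add_eq_zero_right hst, smul_neg, smul_smul, neg_smul]
  -- every `T p` lies in `span {P, Q}` (Lemma 3.2 (i) in `V`)
  have hspan : ∀ p : Polynomial ℝ, p.natDegree ≤ κ → ∃ a b : ℝ, T p = a • P + b • Q := by
    intro p hp
    by_contra hnot
    push Not at hnot
    have hmem : ∀ i, ![(T p).toMvPolynomial i₀, P.toMvPolynomial i₀, Q.toMvPolynomial i₀] i ∈ V := by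
      intro i
      fin_cases i
      · exact hmemV _ hp
      · exact hmemV _ hp₀
      · exact hmemV _ hp₁
    refine not_linearIndependent_of_forall_mem hV hmem (Fintype.linearIndependent_iff.2 fun g hg => ?_)
    have hg' : g 0 • T p + g 1 • P + g 2 • Q = 0 := by
      apply hιinj
      rw [map_zero, map_add, map_add, map_smul, map_smul, map_smul, hι, hι, hι]
      simpa [Fin.sum_univ_three] using hg
    have hg0 : g 0 = 0 := by
      by_contra hg0
      refine hnot (-((g 0)⁻¹ * g 1)) (-((g 0)⁻¹ * g 2)) ?_
      have hTf : T p = (g 0)⁻¹ • (g 0 • T p) := by rw [smul_smul, inv_mul_cancel₀ hg0, one_smul]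
      have hsum : g 0 • T p = -(g 1 • P + g 2 • Q) :=
        eq_neg_of_add_eq_zero_left (by rw [← add_assoc]; exact hg')
      rw [hTf, hsum, smul_neg, smul_add, smul_smul, smul_smul, neg_add, neg_smul, neg_smul]
    rw [hg0, zero_smul, zero_add] at hg'
    obtain ⟨h1, h2⟩ := hind _ _ hg'
    intro i
    fin_cases i
    · exact hg0
    · exact h1
    · exact h2
  -- orientation by Theorem 1.9, inside `V ⊆ ℝ[z_σ]`
  rcases isProperPosition_or_of_forall_mem hV (hmemV _ hp₀) (hmemV _ hp₁) with ⟨hP0', -⟩ | hPQ | hQP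
  · exact absurd (Polynomial.toMvPolynomial_injective i₀ (by rw [hP0', map_zero])) hP0
  · obtain ⟨α, β, hαβ⟩ := exists_coord_pair hind
    refine ⟨α.comp T, β.comp T, P, Q, hPs, hQs, (isProperPosition_toMvPolynomial_iff i₀ P Q).1 hPQ,
      fun p hp => ?_⟩
    obtain ⟨a, b, hab⟩ := hspan p hp
    rw [LinearMap.comp_apply, LinearMap.comp_apply, hab, (hαβ a b).1, (hαβ a b).2]
  · have hind' : ∀ s t : ℝ, s • Q + t • P = 0 → s = 0 ∧ t = 0 := fun s t hst =>
      (hind t s (by rwa [add_comm] at hst)).symm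
    obtain ⟨α, β, hαβ⟩ := exists_coord_pair hind'
    refine ⟨α.comp T, β.comp T, Q, P, hQs, hPs, (isProperPosition_toMvPolynomial_iff i₀ Q P).1 hQP,
      fun p hp => ?_⟩
    obtain ⟨a, b, hab⟩ := hspan p hp
    rw [LinearMap.comp_apply, LinearMap.comp_apply, hab, add_comm (a • P), (hαβ b a).1, (hαβ b a).2]

end RankTwo

/-! ## §4 Theorem 1.2 for `n = 1` -/

section Main

variable [Fintype σ] [DecidableEq σ]

/-- **Borcea–Brändén I, Theorem 1.2 for `n = 1`, degree `κ = |σ|`** (any nonempty finite `σ` carrying the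
auxiliary variables). [cite: BorceaBranden2009, §1.1 Thm. 1.2 (case n = 1) and §§2.2, 4 (its proof via the
multi-affine case)] -/
theorem boundedDegree_realStabilityPreserver_iff_card (i₀ : σ) (T : Polynomial ℝ →ₗ[ℝ] Polynomial ℝ) :
    (∀ p : Polynomial ℝ, p.natDegree ≤ Fintype.card σ →
        (∀ t : ℂ, 0 < t.im → (p.map (algebraMap ℝ ℂ)).eval t ≠ 0) →
          (∀ t : ℂ, 0 < t.im → ((T p).map (algebraMap ℝ ℂ)).eval t ≠ 0) ∨ T p = 0) ↔
      ((∃ (α β : Polynomial ℝ →ₗ[ℝ] ℝ) (P Q : Polynomial ℝ),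
          (∀ t : ℂ, 0 < t.im → (P.map (algebraMap ℝ ℂ)).eval t ≠ 0) ∧
          (∀ t : ℂ, 0 < t.im → (Q.map (algebraMap ℝ ℂ)).eval t ≠ 0) ∧
          (∀ t : ℂ, 0 < t.im →
            (Q.map (algebraMap ℝ ℂ) + Polynomial.C Complex.I * P.map (algebraMap ℝ ℂ)).eval t ≠ 0) ∧
          ∀ p : Polynomial ℝ, p.natDegree ≤ Fintype.card σ → T p = α p • P + β p • Q) ∨
        IsRealStable (univariateRealSymbol (Fintype.card σ) T) ∨
        IsRealStable (univariateRealSymbolNeg (Fintype.card σ) T)) := by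
  rw [← isRealStable_realMultiAffineSymbol_liftOpReal_iff i₀,
    ← isRealStable_negInr_realMultiAffineSymbol_liftOpReal_iff i₀]
  constructor
  · intro hT
    rcases forall_apply_or_symbol (liftOpReal i₀ T) (fun f hf hs => liftOpReal_preserves i₀ T hT hf hs)
      with himg | hb | hc
    · refine Or.inl (exists_rankTwo_of_forall_apply_poly i₀ T fun p hp => ?_)
      have h := himg (realPolarization σ p) (isMultiAffine_realPolarization p)
      rw [liftOpReal_apply, diagonal_realPolarization hp] at h
      rcases h with h | h
      · exact Or.inl (Polynomial.toMvPolynomial_injective i₀ (by rw [h, map_zero]))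
      · exact Or.inr ((isRealStable_toMvPolynomial_iff i₀ _).1 h)
    · exact Or.inr (Or.inl hb)
    · exact Or.inr (Or.inr hc)
  · rintro (⟨α, β, P, Q, -, -, hPQ, hαβ⟩ | hb | hc) p hp hs
    · -- (a) ⇒ preserver: Hermite–Kakeya–Obreschkoff (Thm. 1.9) through `ι`
      have hpp := (isProperPosition_toMvPolynomial_iff i₀ P Q).2 hPQ
      rcases hpp.pencil (α p) (β p) with h0 | hst
      · right
        apply Polynomial.toMvPolynomial_injective i₀
        rw [hαβ p hp, map_add, map_smul, map_smul, smul_eq_C_mul, smul_eq_C_mul, h0, map_zero]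
      · left
        rw [hαβ p hp, ← isRealStable_toMvPolynomial_iff i₀, map_add, map_smul, map_smul, smul_eq_C_mul,
          smul_eq_C_mul]
        exact hst
    · exact preserves_of_liftOpReal i₀ T (fun f hf hs' => realStabilityPreserver_of_symbol hb hf hs') hp hs
    · exact preserves_of_liftOpReal i₀ T (fun f hf hs' => realStabilityPreserver_of_symbol_neg hc hf hs') hp hs

omit [Fintype σ] [DecidableEq σ] in
/-- **Borcea–Brändén I, Theorem 1.2 for `n = 1` (real stability preservers on real polynomials of degree at
most `κ`, `κ ≥ 1`).** A linear operator `T` on `ℝ[t]` maps every real stable polynomial of degree `≤ κ` to a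
real stable polynomial or to `0` if and only if either (a) `T(p) = α(p)P + β(p)Q` on `ℝ_κ[t]` with linear
functionals `α, β` and real stable `P ≪ Q`, or (b) `G_T(z,w) = Σ_{k≤κ} binom(κ,k) T(z^k)(z) w^{κ-k} ∈ 𝓗_2(ℝ)`, or
(c) `G_T(z,-w) ∈ 𝓗_2(ℝ)`. [cite: BorceaBranden2009, §1.1 Thm. 1.2 (case n = 1)] -/
theorem boundedDegree_realStabilityPreserver_iff {κ : ℕ} (hκ : 0 < κ) (T : Polynomial ℝ →ₗ[ℝ] Polynomial ℝ) :
    (∀ p : Polynomial ℝ, p.natDegree ≤ κ →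
        (∀ t : ℂ, 0 < t.im → (p.map (algebraMap ℝ ℂ)).eval t ≠ 0) →
          (∀ t : ℂ, 0 < t.im → ((T p).map (algebraMap ℝ ℂ)).eval t ≠ 0) ∨ T p = 0) ↔
      ((∃ (α β : Polynomial ℝ →ₗ[ℝ] ℝ) (P Q : Polynomial ℝ),
          (∀ t : ℂ, 0 < t.im → (P.map (algebraMap ℝ ℂ)).eval t ≠ 0) ∧
          (∀ t : ℂ, 0 < t.im → (Q.map (algebraMap ℝ ℂ)).eval t ≠ 0) ∧
          (∀ t : ℂ, 0 < t.im →
            (Q.map (algebraMap ℝ ℂ) + Polynomial.C Complex.I * P.map (algebraMap ℝ ℂ)).eval t ≠ 0) ∧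
          ∀ p : Polynomial ℝ, p.natDegree ≤ κ → T p = α p • P + β p • Q) ∨
        IsRealStable (univariateRealSymbol κ T) ∨ IsRealStable (univariateRealSymbolNeg κ T)) := by
  have h := boundedDegree_realStabilityPreserver_iff_card (⟨0, hκ⟩ : Fin κ) T
  simp only [Fintype.card_fin] at h
  exact h

end Main

end Literature.Combinatorics.StablePolynomials

end
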